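import Summits.QuantumFields.YangMills.Theorems.BalabanUVNodesN12DirectSurjHsurjSupport

/-!
# BalabanUVNodes ∕ N12 — (P4)′, A PER-HEIGHT LETTER OF THE FLAT CHART DERIVATIVE, UNIFORM OVER DETERMINING SETS (prelim of the uniform-`B` edition)

Cell `pub-ymgap` (HUMAN RULINGS D-0062 ∕ D-0149), WIDTH SEAT `pub-ymgap-dag-n12-w6` g9 (node N12 = [B15]; key K1⁹ `stmt-QuantumFields-27364`, `--kind proof --supports … --as helper`;
count-neutral).  THEOREMS ONLY (0 `def`, 0 `instance`, 0 `sorry`).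

WHY.  In the (P4)′ letter of record (dag-n12-w6 p664681 ∕ p678596 ∕ p685568 `exists_rightInverse_letter_support_of_proxies`) the sup-norm constant `B = β(k+1)(1+Λβ)^{k+1}` is chosen AFTER the
instance `(M₁, Z)` («LOCATED-B») for exactly one reason: `Λ = Λ₀ + C₁ρ₁Cp + 1` reads a letter `Λ₀` of the FLAT chart derivative `DΦ♭_{𝐁_k(Z)}(0)` obtained from `bound_of_continuous` per
determining set.  But `(DΦ♭_𝐁(0)X)_{(j,c)} = π((Q^{(j)}↑X)(c))` (dag-n10-w1 `fderiv_msChart_one_apply_eq_iterLin`) for EVERY `𝐁`, and `‖(Q^{(j)}Z)(c)‖ ≤ (3(d+2)L)^j·sup‖Z‖` (the EML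
one-step sup bound `norm_linAvg_le` iterated), so ONE `Λ♭ := c_π·(3(d+2)L)^k` per height serves every determining set of levels `≤ k`.

CONTENTS.  `norm_iterLin_le_pow` (`‖(Q^{(j)}Z)(c)‖ ≤ (3(d+2)L)^j·M`), ★ `exists_flatDeriv_letter` (`∃ Λ♭ ≥ 0, ∀ 𝐁 X, ‖DΦ♭_𝐁(0) X‖ ≤ Λ♭‖X‖`, levels `≤ k`).

HONEST FRAMING.  Bookkeeping by name; `c_π` is the bound of the projection `π : M_N(ℂ) → 𝔰𝔲(N)` (an existential real, `N`-dependent only); nothing of Bałaban's asserted or refuted; N12 NOT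
discharged; K1⁹ NOT closed; count-neutral; R4 closes only the conditional finite-`𝕋⁴` rung `BalabanLadder.UV`; no summit statement is proved here and NOT the Yang–Mills mass gap (Clay).
-/

noncomputable section

open scoped BigOperators Matrix.Norms.L2Operator Topology NNReal
open Filter

namespace Summit.QuantumFields.YangMills.BalabanUVNodes.N12DirectSurjHsurjUniformBPrelim

open Literature.MathematicalPhysics.QuantumFieldTheory.Balaban1983to89
open Node00 B15DeterminingSets
open T4Continuum (T4Family)
open BlockAveragingEMLLinearised (linAvg)
open T4AdjointCovarianceUnitary (lieSU)
open B16Ineq19NearFlatSliceNorms (opNorm_coe_le_norm_lieSU)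
open Summit.QuantumFields.YangMills.Theorems.Prop7AvgLinearisation (norm_linAvg_le)
open Summit.QuantumFields.YangMills.BalabanUVNodes.N12FlatChartDerivIterLin (fderiv_msChart_one_apply_eq_iterLin)
open Summit.QuantumFields.YangMills.BalabanUVNodes.N12GuardedChartDerivDeviation (exists_norm_suProj_le)

/-- **SUP BOUND OF `Q^{(j)}`**: `‖(Q^{(j)}Z)(c)‖ ≤ (3(d+2)L)^j·M` whenever `‖Z_b‖ ≤ M` on the fine bonds (`norm_linAvg_le` iterated; a public copy of dag-n10-w1's private plumbing).
[cite: Balaban1985Averaging, (124)-(125) p.36] -/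
theorem norm_iterLin_le_pow {P : Params} {n : Type*} [Fintype n] [DecidableEq n]
    (Q : (i : ℕ) → (PBond P 0 → Matrix n n ℂ) → PBond P i → Matrix n n ℂ)
    (hQ0 : ∀ Y, Q 0 Y = Y) (hQs : ∀ (i : ℕ) (Y : PBond P 0 → Matrix n n ℂ) (c : PBond P (i + 1)), Q (i + 1) Y c = linAvg (Q i Y) c)
    (Z : PBond P 0 → Matrix n n ℂ) {M : ℝ} (hM : 0 ≤ M) (hZ : ∀ b, ‖Z b‖ ≤ M) :
    ∀ (k : ℕ) (c : PBond P k), ‖Q k Z c‖ ≤ (3 * (((P.d + 2) * P.L : ℕ) : ℝ)) ^ k * M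
  | 0, c => by rw [hQ0, pow_zero, one_mul]; exact hZ c
  | k + 1, c => by
    rw [hQs, pow_succ, mul_comm ((3 * (((P.d + 2) * P.L : ℕ) : ℝ)) ^ k), mul_assoc]
    exact norm_linAvg_le (Q k Z) (by positivity) (fun b => norm_iterLin_le_pow Q hQ0 hQs Z hM hZ k b) c

variable {F : T4Family} {N : ℕ} [NeZero N]

/-- ★ **A PER-HEIGHT LETTER OF THE FLAT CHART DERIVATIVE, UNIFORM OVER DETERMINING SETS**: one `Λ♭ ≥ 0` per `(F, K, k, N)` with `‖DΦ♭_𝐁(0) X‖ ≤ Λ♭·‖X‖` for EVERY determining set `𝐁`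
(chart of the constrained bonds of levels `≤ k` at the flat configuration with its own flat datum) and every direction `X` — `Λ♭ = c_π·(3(d+2)L)^k`, since each row is `π((Q^{(j)}↑X)(c))`,
`j ≤ k`.  Replaces the per-instance `bound_of_continuous` letter `Λ₀` of p664681 ∕ p678596 ∕ p685568 (the only instance-dependence of their `B`).
[cite: Balaban1985Variational, (44)-(48) p.285; Balaban1985Averaging, Prop. 3 (121)-(125) p.36] -/
theorem exists_flatDeriv_letter (K k : ℕ) :
    ∃ Λ : ℝ, 0 ≤ Λ ∧ ∀ (𝔹 : DetSet (F.P K)) (X : PBond (F.P K) 0 → lieSU (Fin N)),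
      ‖fderiv ℝ (msChart F N K k 𝔹 (avgFamily (avOfRecord F N K) (1 : GaugeField (F.P K) 0 (SU N))) (1 : GaugeField (F.P K) 0 (SU N))) 0 X‖ ≤ Λ * ‖X‖ := by
  classical
  obtain ⟨cπ, hcπ, hπ⟩ := exists_norm_suProj_le (N := N)
  obtain ⟨Q, hQ0, hQs⟩ : ∃ Q : (i : ℕ) → (PBond (F.P K) 0 → Matrix (Fin N) (Fin N) ℂ) → PBond (F.P K) i → Matrix (Fin N) (Fin N) ℂ,
      (∀ Y, Q 0 Y = Y) ∧ ∀ (i : ℕ) (Y : PBond (F.P K) 0 → Matrix (Fin N) (Fin N) ℂ) (c : PBond (F.P K) (i + 1)), Q (i + 1) Y c = linAvg (Q i Y) c :=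
    ⟨fun i => Nat.rec (motive := fun i => (PBond (F.P K) 0 → Matrix (Fin N) (Fin N) ℂ) → PBond (F.P K) i → Matrix (Fin N) (Fin N) ℂ) (fun Y => Y)
      (fun _ Qi Y c => linAvg (Qi Y) c) i, fun _ => rfl, fun _ _ _ => rfl⟩
  set a : ℝ := 3 * (((((F.P K).d + 2) * (F.P K).L : ℕ)) : ℝ) with ha_def
  have ha1 : 1 ≤ a := by
    rw [ha_def]
    have h1 : (1 : ℕ) ≤ ((F.P K).d + 2) * (F.P K).L := Nat.one_le_iff_ne_zero.2 (Nat.mul_ne_zero (by omega) (F.P K).L_pos.ne')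
    have h2 : (1 : ℝ) ≤ ((((F.P K).d + 2) * (F.P K).L : ℕ) : ℝ) := by exact_mod_cast h1
    linarith
  refine ⟨cπ * a ^ k, mul_nonneg hcπ (pow_nonneg (zero_le_one.trans ha1) _), fun 𝔹 X => ?_⟩
  refine (pi_norm_le_iff_of_nonneg (mul_nonneg (mul_nonneg hcπ (pow_nonneg (zero_le_one.trans ha1) _)) (norm_nonneg _))).2 fun i => ?_
  rw [fderiv_msChart_one_apply_eq_iterLin Q hQ0 hQs 𝔹 X i]
  have hj : (((constrEnum 𝔹 k).symm i).1 : ℕ) ≤ k := Nat.lt_succ_iff.1 ((constrEnum 𝔹 k).symm i).1.2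
  have hX : ∀ b, ‖((X b : lieSU (Fin N)) : Matrix (Fin N) (Fin N) ℂ)‖ ≤ ‖X‖ := fun b => (opNorm_coe_le_norm_lieSU (X b)).trans (norm_le_pi_norm X b)
  have hQ := norm_iterLin_le_pow Q hQ0 hQs (fun b => ((X b : lieSU (Fin N)) : Matrix (Fin N) (Fin N) ℂ)) (norm_nonneg X) hX
    (((constrEnum 𝔹 k).symm i).1 : ℕ) ((constrEnum 𝔹 k).symm i).2.1
  calc ‖suProj N (Q (((constrEnum 𝔹 k).symm i).1 : ℕ) (fun b => ((X b : lieSU (Fin N)) : Matrix (Fin N) (Fin N) ℂ)) ((constrEnum 𝔹 k).symm i).2.1)‖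
      ≤ cπ * ‖Q (((constrEnum 𝔹 k).symm i).1 : ℕ) (fun b => ((X b : lieSU (Fin N)) : Matrix (Fin N) (Fin N) ℂ)) ((constrEnum 𝔹 k).symm i).2.1‖ := hπ _
    _ ≤ cπ * (a ^ (((constrEnum 𝔹 k).symm i).1 : ℕ) * ‖X‖) := mul_le_mul_of_nonneg_left hQ hcπ
    _ ≤ cπ * (a ^ k * ‖X‖) := mul_le_mul_of_nonneg_left (mul_le_mul_of_nonneg_right (pow_le_pow_right₀ ha1 hj) (norm_nonneg _)) hcπ
    _ = cπ * a ^ k * ‖X‖ := by ring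

end Summit.QuantumFields.YangMills.BalabanUVNodes.N12DirectSurjHsurjUniformBPrelim

end
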